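import Mathlib
import Summits.ResolutionOfSingularities.ResolutionOfSingularities.Theorems.WeightedInvariantLocalWeightedDropNCResSurfGraphIdeal

/-!
# `WeightedInvariant.LocalWeightedDrop`: NC-resolution settings for the TOT₂ line — GRAPH SURFACES, part 9: TRANSPORT OF THE SURFACE IDEAL TO A
# WEIGHTED ORDER (the permissibility inequality (P1) for a centre INSIDE the surface, e.g. the curve `Γ_a = S ∩ E_a` of the curve move)

Crux item stmt-ResolutionOfSingularities-8899 `LocalWeightedDrop` (route `ResolutionOfSingularities/WeightedInvariant`), ENGINE skeleton v32/v33, residuals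
`stub_spaceNCRankDrop` / `stub_wildWideApexFourStartsWon` (res-L1-w43-strat-1's line `directrix-cut` v3.1, piece PL = `ApexPlaneExit`, SURFACE sub-case;
design memo `L/res-L1-w43-stub-4/g5/S-E2-SURF.md` §6).  [OURS · L1 W4.3 · chain w43 · seat res-L1-w43-stub-4 gen 5; def-free on part 2; the count game
is the programme's own; nothing here is a statement of any manuscript; AI-produced, gate-checked, weaker than expert review.]

* `le_weightedOrder_finsuppProd` — `Σ_j D_j · ord_w(Λ_j) ≤ ord_w(∏_j Λ_j^{D_j})`;
* **`le_weightedOrder_subst_of_inOffPlaneIdeal`** — if `G ∈ (x_j : j ∉ {a,b})^c` (`InOffPlaneIdeal a b c G`) and a substitution `Λ` sends every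
  off-base letter to a series of `w`-weighted order `≥ 1`, then `c ≤ weightedOrder_w (Λ^* G)`.  With `Λ = τ` of memo §6 (`τ_l = x_l − ψ_l(x_a, x_b)`
  on the boundary letters containing `Γ_a`, identity elsewhere) and `w = 𝟙_{≠ b}` this is (P1) for the curve move along `Γ_a`; with `w` the indicator
  of the off-base letters and `Λ = id` it recovers part 1's `le_weightedOrder_of_inOffPlaneIdeal`.
* `one_le_weightedOrder_X_of_ne_zero`, `one_le_weightedOrder_of_constantCoeff_zero_of_dvd` — the two ways the hypothesis on `Λ_j` is met
  (`Λ_j = x_j` with `w_j = 1`; `Λ_j = x_j − ψ_j(x_a, x_b)` with `w_j = w_a = 1` and `x_a ∣ ψ_j(x_a, x_b)`): stated as the general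
  `one_le_weightedOrder_iff_coeff_zero`-type criterion `∀ d, weight_w d = 0 → coeff d F = 0`.
-/

set_option linter.dupNamespace false -- mandated namespace of this single-conjunct summit

noncomputable section

namespace Summit.ResolutionOfSingularities.ResolutionOfSingularities.Theorems

namespace TameFourTupleDrop

namespace GraphSurf

open MvPowerSeries Literature.AlgebraicGeometry.Resolution

variable {k : Type} [Field k] {m : ℕ}

/-- `Σ_j D_j · ord_w(Λ_j) ≤ ord_w(∏_j Λ_j^{D_j})`. -/
theorem le_weightedOrder_finsuppProd {σ : Type} (w : σ → ℕ) (D : Fin (m + 1) →₀ ℕ) (Λ : Fin (m + 1) → MvPowerSeries σ k) :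
    ∑ j ∈ D.support, D j • (Λ j).weightedOrder w ≤ (D.prod fun j n => Λ j ^ n).weightedOrder w := by
  rw [Finsupp.prod]
  refine le_trans (Finset.sum_le_sum fun j _ => le_weightedOrder_pow (w := w) (f := Λ j) (D j)) ?_
  exact le_weightedOrder_prod w (fun j => Λ j ^ D j) D.support

/-- **TRANSPORT OF THE SURFACE IDEAL TO A WEIGHTED ORDER.**  If `G ∈ (x_j : j ∉ {a,b})^c` and the substitution `Λ` sends every off-base letter to
a series of `w`-weighted order `≥ 1`, then `c ≤ weightedOrder_w (Λ^* G)`. -/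
theorem le_weightedOrder_subst_of_inOffPlaneIdeal {σ : Type} {a b : Fin (m + 1)} {c : ℕ} {G : MvPowerSeries (Fin (m + 1)) k}
    (hG : InOffPlaneIdeal a b c G) (w : σ → ℕ) (Λ : Fin (m + 1) → MvPowerSeries σ k) (hΛ : HasSubst Λ)
    (hoff : ∀ j, ¬ (j = a ∨ j = b) → (1 : ℕ∞) ≤ (Λ j).weightedOrder w) :
    (c : ℕ∞) ≤ (subst Λ G).weightedOrder w := by
  classical
  apply le_weightedOrder
  intro E hE
  rw [coeff_subst hΛ G E]
  have hterm : ∀ D : Fin (m + 1) →₀ ℕ, coeff D G • coeff E (D.prod fun j n => Λ j ^ n) = 0 := by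
    intro D
    by_cases hD : coeff D G = 0
    · rw [hD, zero_smul]
    · have hc : c ≤ offDeg₂ a b D := hG D hD
      -- the weighted order of the `D`-th product is at least its off-base degree
      have hprod : (offDeg₂ a b D : ℕ∞) ≤ (D.prod fun j n => Λ j ^ n).weightedOrder w := by
        refine le_trans ?_ (le_weightedOrder_finsuppProd w D Λ)
        calc (offDeg₂ a b D : ℕ∞) = ∑ j ∈ (Finset.univ.erase a).erase b, ((D j : ℕ) : ℕ∞) := by
              rw [offDeg₂, Nat.cast_sum]
          _ ≤ ∑ j ∈ (Finset.univ.erase a).erase b, D j • (Λ j).weightedOrder w :=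
              Finset.sum_le_sum fun j hj => by
                calc ((D j : ℕ) : ℕ∞) = D j • (1 : ℕ∞) := by rw [nsmul_eq_mul, mul_one]
                  _ ≤ D j • (Λ j).weightedOrder w := nsmul_le_nsmul_right (hoff j (mem_offBase_iff.mp hj)) _
          _ ≤ ∑ j ∈ Finset.univ, D j • (Λ j).weightedOrder w :=
              Finset.sum_le_sum_of_subset_of_nonneg (Finset.subset_univ _) fun _ _ _ => bot_le
          _ = ∑ j ∈ D.support, D j • (Λ j).weightedOrder w := by
              rw [← Finset.sum_subset (Finset.subset_univ D.support)]
              intro j _ hj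
              rw [Finsupp.notMem_support_iff.mp hj, zero_smul]
      have hlt : ((Finsupp.weight w E : ℕ) : ℕ∞) < (D.prod fun j n => Λ j ^ n).weightedOrder w :=
        lt_of_lt_of_le (lt_of_lt_of_le hE (by exact_mod_cast hc)) hprod
      rw [coeff_eq_zero_of_lt_weightedOrder w hlt, smul_zero]
  rw [finsum_congr hterm, finsum_zero]

/-- A series without monomials of `w`-weight `0` has `w`-weighted order `≥ 1`. -/
theorem one_le_weightedOrder_of_coeff_weight_zero {σ : Type} (w : σ → ℕ) {F : MvPowerSeries σ k}
    (h : ∀ d : σ →₀ ℕ, Finsupp.weight w d = 0 → coeff d F = 0) : (1 : ℕ∞) ≤ F.weightedOrder w := by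
  apply le_weightedOrder
  intro d hd
  refine h d ?_
  have : (Finsupp.weight w d : ℕ∞) < 1 := hd
  exact_mod_cast Nat.lt_one_iff.mp (by exact_mod_cast this)

/-- A weight-`1` letter has weighted order `≥ 1`. -/
theorem one_le_weightedOrder_X {σ : Type} (w : σ → ℕ) {j : σ} (hj : w j = 1) :
    (1 : ℕ∞) ≤ (X j : MvPowerSeries σ k).weightedOrder w := by
  classical
  refine one_le_weightedOrder_of_coeff_weight_zero w fun d hd => ?_
  rw [coeff_X]
  split_ifs with h
  · exfalso
    rw [h, Finsupp.weight_single, hj, smul_eq_mul, mul_one] at hd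
    exact one_ne_zero hd
  · rfl

end GraphSurf

end TameFourTupleDrop

end Summit.ResolutionOfSingularities.ResolutionOfSingularities.Theorems

end
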